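import Literature.MathematicalPhysics.QuantumFieldTheory.Federbush1986.PhaseCellIVGaugeInterpolation

/-!
# Federbush, *A phase cell approach to Yang–Mills theory. IV. The choice of variables* (CMP **114** (1988) 317–343) —
# §4 «Ordering of Excitations» (O1–O4), §5 «Prelude» (5.1)–(5.3), §6 «Gauge Invariant Coupling – Laying Down an Excitation»
# (6.1)–(6.13), §7 «Gauge Invariant Coupling – An Epiphany» (Gauge Twist Relations (7.1), (7.2)) and the radial axial gauge
# (10.4) of §10 — TYPED, with the algebraic statements PROVED (pure-gauge backgrounds drop out of plaquette variables, p. 330;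
# Gauge Twist Relations 1 and 2 for the same-level coupling; the tree gauge (10.4) is trivial on the tree)

statement-level skeleton of published theorems with citation tags; proofs where landed; nothing here is a claim about the Yang–Mills mass gap

Cell `lit-balaban`, reader/typer block **r19** (F4 fold owner), inventory rows `F4.Def§4` (§§4–7) and `F4.Def§8` (§§8–10, here
only (10.4)) of `run/shared/lean/pub/lit-balaban/lit-balaban-r19/ROWS-F4.md`; companion of `PhaseCellIVGaugeInterpolation`
(§11; its `PhaseCellIVGauge.walkProd` = ordered product of bond variables along a lattice path is the `u(e)` of (6.6)) and
`PhaseCellIVLatticeHierarchy` (§1).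

**Source.** P. Federbush, Commun. Math. Phys. **114** (1988) 317–343 [bib `Federbush1988PhaseCellIV`; doi:10.1007/bf01225039;
lit store `paper:doi-10-1007-bf01225039`; journal page = PDF page + 316], pp. 327–331 [PDF 11–15] and 334 [PDF 18] READ AS
IMAGES (renders `lit-balaban-r19/renders/f4/f4-p011.png` … `f4-p015.png`, `f4-p018.png`).  Verbatim:

* §4 p. 327: «We select an ordering on excitations, the *Universal Excitation Ordering*.  We will write `E₁ < E₂` if excitation
  `E₁` occurs before excitation `E₂` in this ordering.  The ordering will have the following properties: O1) If excitation
  `E₁` is lower effective level than excitation `E₂` then `E₂ < E₁`.  (Recall lower level corresponds to higher `r` value,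
  shorter length scale.)  O2) If `E₁` and `E₂` have the same effective level, and `E₁` is a `p`-mode and `E₂` is not, then
  `E₁ < E₂`.  O3) If `E₁` and `E₂` have the same effective level, and `E₁` is an `A`-mode and `E₂` is not, then `E₂ < E₁`. …
  O4) The ordering of chunks, of the same effective level, is determined depending on their pinnings, and edges belonging to
  them.  The ordering of modes is by their home edges. …  We have ordered the set of all possible excitations (we have a
  total ordering).  In any given `S − L` configuration only some of the chunks appear, and some of the `p`-modes may be
  absent.  This subset will be ordered (by the subset ordering)».
* §5 p. 327–328: «We denote this ordered sequence as `E₁, E₂, …`. (5.1) …  We denote the isolated fields of the excitations in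
  (5.1) by `𝒞₁, 𝒞₂, …`. (5.2) …  We first discuss a partition of unity on `R⁴` with functions labelled by points `α ∈ Z⁴`.
  `1 = Σ_{α∈Z} φ_α(x)`, `x ∈ R⁴`. (5.3)  The `φ_α` are `C^∞` with the properties 1) `{φ_α(x)}` is translation invariant.  That
  is, `φ_α(x) = φ(x − α)` for some function `φ(x)`.  2) `φ(x)` is invariant under the discrete symmetries of the lattice `Z⁴`
  (with origin fixed).  (This requirement is not necessary.)  3) `φ(0) = 1`,  4) `φ(x) = 0` if `|x| > 2`. …  By scaling the
  partition of unity, we get a partition of unity, for each `r`, with elements associated to the vertices in `𝒱^r`.  [One is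
  replacing `φ(x)` by `φ(N^r x)`.]»
* §6 p. 329–330: «`𝓕_{n−1} = 𝒞_{n−1} × 𝒞_{n−2} × … × 𝒞₁`, (6.1) and we wish to define `𝓕_n = 𝒞_n × 𝓕_{n−1}`. (6.2) …  `G(n−1, e)`
  is the bond variable (assignment) at edge `e` due to the first `n−1` excitations, and `g(n, e)` is the assignment of the
  isolated field of `E_n` to edge `e`. …  `r′ < r`.  In this case we simply set `G(n, e) = G(n−1, e)`. (6.3)  `r′ = r`. … even
  if `G(n−1, ∂p) = Id` for all `p` in `𝒫^r` … one would not necessarily have `|G(n, ∂p)| = |g(n, ∂p)|` for all `p` in `𝒫^r`.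
  This we desire.  We are still going to set `G(n, e) = G(n−1, e)` (6.4) for all `e` for which `g(n, e) = Id`. …  Let `e` be an
  edge in `ℰ^r` whose tail end is `v(n)` (one of eight such).  We then set `G(n, e) = g(n, e) G(n−1, e)` (6.5) …  Now let
  `e ∈ ℰ^n` [sic; `ℰ^r`] be an arbitrary edge.  We let `e = v_a v_b` and consider the portion of `t_{v(n)}` between `v(n)` and
  `v_a`, `t_{v(n)v_a}`. … `e₁, e₂ … e_s` the path `t_{v(n)v_a}`; … we now define `u(e) = G(n−1, e₁) G(n−1, e₂) … G(n−1, e_s)`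
  (6.6) and in terms of `u(e)`, set `G(n, e) = u⁻¹(e) g(n, e) u(e) G(n−1, e)`. (6.7)  We leave to the reader to check that with
  this definition we have achieved our purpose of making pure gauge background fields not contribute to plaquette variables.»
  p. 330–331: «We associate to `Γ = t(v₁, v₂, …, v_s)` the weighting `w(Γ) = φ_{v₂}(ê) φ_{v₃}(ê) … φ_{v_{s−1}}(ê)`, (6.8) … Note
  that `Σ_Γ w(Γ) = 1`, (6.9) where we fix `v₁` and `v_s` in the sum. …  *Procedure for Modes.* We define `G_Γ(n, e)` by
  `u⁻¹(Γ) g(n, e) u(Γ) G(n−1, e)`, (6.10) and find `G(n, e)` by minimizing `Σ_Γ w(Γ) d²(G(n, e), G_Γ(n, e))`. (6.11)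
  *Procedure for Chunks.* We define `ū` by minimizing `Σ_Γ w(Γ) d²(ū, u(Γ))`. (6.12)  We then set `G(n, e) = ū⁻¹ g(n, e) ū
  G(n−1, e)`. (6.13) …  In both cases we will operate in a situation where the indicated minima are unique.»
* §7 p. 331: «We let `h_v(𝒢)` be the group element assigned to vertex `v` by `𝒢`.  (A gauge transformation is exactly an
  assignment for all vertices of an element of `G`. …)  If `𝒞_i` is the isolated field of an excitation, we will write `𝒞_i^g`
  for the isolated field that is obtained by transforming each edge assignment `g(i, e)` to the assignment `g g(i, e) g⁻¹` (for
  a fixed `g ∈ G`).  We abbreviate `𝒞_i^{h_{v(i)}(𝒢)}` by `𝒞_i^{t(𝒢)}`.  We obtain the basic result *Gauge Twist Relation 1.*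
  `(𝒞 × 𝓕)^𝒢 = 𝒞^{t(𝒢)} × 𝓕^𝒢`, (7.1) from which may be obtained by induction *Gauge Twist Relation 2.* `(𝒞_n × … × 𝒞₁)^𝒢 =
  𝒞_n^{t(𝒢)} × … × 𝒞₁^{t(𝒢)} × 1^𝒢`. (7.2)  `1` is the "trivial" field all of whose edge assignments are the identity.»
* §10 p. 334: «Let `t_v` be the tree in `ℒ^r` centered at `v`, as previously defined.  We switch to a gauge where the
  assignments to the bonds of `t_v` are trivial (= Id).  For any lattice vertex, `v′`, we set `u(v′) = u(t_{vv′})`, the `u`'s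
  as in Sect. 6 (with a slight change in notation).  The assignment in the new gauge, `h(e)`, for `e = v_a v_b` in `ℒ^r` is
  `h(e) = u(v_a) g(e) u⁻¹(v_b)`. (10.4)»

**What this file does.**  Abstract carrier: a vertex type `V`, a group `G`, bond fields `V → V → G` on ordered pairs, a tree
`T` on `V` (print: `t_{v(n)}`, the radial tree at the pinning vertex, a maximal tree of the lattice) with its unique paths.
* §1 (§4) `ExcitationKind`, the key `uoKey` (effective level, then kind rank `p`-mode < chunk < `A`-mode, then print's O4
  tie-break = any linear order on the excitations) and the Universal Excitation Ordering `UOLt`; O1, O2, O3 and totality /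
  transitivity / irreflexivity PROVED.
* §2 (§5) `IsLatticePOU φ` = (5.3) with 1), 3), 4) (property 2) is «not necessary»); the scaled family `φ_v`, `v ∈ 𝒱^r`,
  and its partition-of-unity identity (PROVED from (5.3)); the weights (6.8) for `s = 3` and (6.9) in that case.  The
  EXISTENCE of a `φ` with (5.3) is not proved in this file.
* §3 (§6, `r′ ≤ r`) `pathProd` (= `u` of (6.6) along the unique tree path), `couple` (= (6.7); (6.5) when `v_a = v(n)`, (6.4)
  when `g(n, e) = Id`, PROVED); the reader's exercise p. 330 PROVED: for a PURE GAUGE background `G(n−1, v_av_b) = k(v_a)⁻¹k(v_b)`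
  the coupled field is `k(v_a)⁻¹ [c g(n, e) c⁻¹] k(v_b)` with the constant `c = k(v(n))` (`couple_pureGauge`), so every
  plaquette variable of `𝒞_n × 𝓕_{n−1}` is conjugate to that of `g(n, ·)` (`couple_plaquette_conj`).
* §4 (§6, `r′ > r`) the procedures (6.10)–(6.13) as `IsMinOn` predicates for given weights `w(Γ)` and path products `u(Γ)`
  (definitions; the averaging over trees is print's, the minimisers are hypotheses as in print).
* §5 (§7) gauge transformations `gaugeAct h F (a, b) = h(a) F(a,b) h(b)⁻¹`, the conjugated isolated field `conjField c g`, and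
  **Gauge Twist Relation 1** (7.1) PROVED for the couplings (6.3) and (6.5)–(6.7) (`gaugeTwist₁`), **Gauge Twist Relation 2**
  (7.2) PROVED for every finite sequence of same-level couplings (`gaugeTwist₂`).
* §6 (§10) the radial axial gauge (10.4) `treeGauge` and «the assignments to the bonds of `t_v` are trivial (= Id)» PROVED
  (`treeGauge_eq_one_of_adj`).
* §7 (v1.1) Gauge Twist Relation 1 for the AVERAGED procedures (6.10)–(6.13) (`r′ > r`): for a bi-invariant distance on `G`
  the minimisers transform covariantly (`IsModeCoupling.twist`, `IsAveragedPathProd.twist`, `chunkCouple_twist`) — PROVED.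
* §8 (v1.1) (6.8) `chainWeight` for any number of intermediate vertices and **(6.9) `Σ_Γ w(Γ) = 1` PROVED in general**
  (`hasSum_chainWeight`; the (5.3)-sums are finite sums over explicit boxes, `sum_pouWindow`).
* §9 (v1.2) the minimisations (6.11)/(6.12) are SOLVABLE on a compact group (`exists_isModeCoupling`,
  `exists_isAveragedPathProd`) and have the unique solution (6.7) in the single-path case (`…_singleton_iff`) — PROVED;
  print's uniqueness «in a situation where the indicated minima are unique» (small fields) is not asserted.
No `sorry`; no new `Prop`-facts except the `IsMinOn`-shaped definitions (6.11)/(6.12), which are definitions.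
-/

namespace Literature.MathematicalPhysics.QuantumFieldTheory.Federbush1986

noncomputable section

open Set

namespace PhaseCellIVCoupling

open PhaseCellIVGauge

/-! ## 1. §4 the Universal Excitation Ordering -/

/-- The three kinds of excitations: pure modes (`p`-modes), chunks, averaging correction modes (`A`-modes).
[cite: Federbush1988PhaseCellIV, §4 p. 327; §0 p. 321] -/
inductive ExcitationKind
  | pMode
  | chunk
  | aMode
  deriving DecidableEq

/-- The rank used by O2/O3: at equal effective level `p`-modes come first and `A`-modes last.
[cite: Federbush1988PhaseCellIV, §4 O2), O3) p. 327] -/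
def ExcitationKind.rank : ExcitationKind → ℕ
  | .pMode => 0
  | .chunk => 1
  | .aMode => 2

/-- `rank` is injective. [cite: Federbush1988PhaseCellIV, §4 p. 327] -/
theorem ExcitationKind.rank_injective : Function.Injective ExcitationKind.rank := by
  intro a b h; cases a <;> cases b <;> simp_all [ExcitationKind.rank]

variable {X : Type*} (kind : X → ExcitationKind) (effLevel : X → ℕ)

/-- The sort key of the Universal Excitation Ordering: (effective level, kind rank, the excitation itself in print's O4
tie-break order — «determined depending on their pinnings, and edges», here ANY linear order on `X`), lexicographically.
[cite: Federbush1988PhaseCellIV, §4 O1)–O4) p. 327] -/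
def uoKey (E : X) : ℕ ×ₗ (ℕ ×ₗ X) := toLex (effLevel E, toLex ((kind E).rank, E))

/-- The key is injective (so the induced order is total). [cite: Federbush1988PhaseCellIV, §4 p. 327] -/
theorem uoKey_injective : Function.Injective (uoKey kind effLevel) := by
  intro a b h
  simp only [uoKey, toLex_inj, Prod.mk.injEq] at h
  exact h.2.2

variable [LinearOrder X]

/-- **The Universal Excitation Ordering** «`E₁ < E₂` if excitation `E₁` occurs before excitation `E₂`»: coarser effective
level first (O1), at equal level `p`-modes first (O2) and `A`-modes last (O3), then the tie-break (O4).
[cite: Federbush1988PhaseCellIV, §4 p. 327] -/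
def UOLt (E₁ E₂ : X) : Prop := uoKey kind effLevel E₁ < uoKey kind effLevel E₂

/-- Unfolding of `UOLt`. [cite: Federbush1988PhaseCellIV, §4 p. 327] -/
theorem uoLt_iff (E₁ E₂ : X) : UOLt kind effLevel E₁ E₂ ↔
    effLevel E₁ < effLevel E₂ ∨ effLevel E₁ = effLevel E₂ ∧
      ((kind E₁).rank < (kind E₂).rank ∨ (kind E₁).rank = (kind E₂).rank ∧ E₁ < E₂) := by
  simp only [UOLt, uoKey, Prod.Lex.toLex_lt_toLex]

/-- «we have a total ordering»: trichotomy. [cite: Federbush1988PhaseCellIV, §4 p. 327] -/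
theorem uoLt_trichotomy (E₁ E₂ : X) : UOLt kind effLevel E₁ E₂ ∨ E₁ = E₂ ∨ UOLt kind effLevel E₂ E₁ := by
  rcases lt_trichotomy (uoKey kind effLevel E₁) (uoKey kind effLevel E₂) with h | h | h
  · exact Or.inl h
  · exact Or.inr (Or.inl (uoKey_injective kind effLevel h))
  · exact Or.inr (Or.inr h)

/-- The ordering is transitive … [cite: Federbush1988PhaseCellIV, §4 p. 327] -/
theorem uoLt_trans {E₁ E₂ E₃ : X} (h₁ : UOLt kind effLevel E₁ E₂) (h₂ : UOLt kind effLevel E₂ E₃) :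
    UOLt kind effLevel E₁ E₃ :=
  lt_trans h₁ h₂

/-- … and irreflexive. [cite: Federbush1988PhaseCellIV, §4 p. 327] -/
theorem uoLt_irrefl (E : X) : ¬UOLt kind effLevel E E := lt_irrefl _

/-- **O1)** «If excitation `E₁` is lower effective level than excitation `E₂` then `E₂ < E₁`.  (Recall lower level corresponds
to higher `r` value, shorter length scale.)» [cite: Federbush1988PhaseCellIV, §4 O1) p. 327] -/
theorem uoLt_O1 {E₁ E₂ : X} (h : effLevel E₂ < effLevel E₁) : UOLt kind effLevel E₂ E₁ :=
  (uoLt_iff kind effLevel E₂ E₁).mpr (Or.inl h)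

/-- **O2)** «If `E₁` and `E₂` have the same effective level, and `E₁` is a `p`-mode and `E₂` is not, then `E₁ < E₂`.»
[cite: Federbush1988PhaseCellIV, §4 O2) p. 327] -/
theorem uoLt_O2 {E₁ E₂ : X} (h : effLevel E₁ = effLevel E₂) (h₁ : kind E₁ = .pMode) (h₂ : kind E₂ ≠ .pMode) :
    UOLt kind effLevel E₁ E₂ := by
  refine (uoLt_iff kind effLevel E₁ E₂).mpr (Or.inr ⟨h, Or.inl ?_⟩)
  rw [h₁]
  revert h₂
  cases kind E₂ <;> simp [ExcitationKind.rank]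

/-- **O3)** «If `E₁` and `E₂` have the same effective level, and `E₁` is an `A`-mode and `E₂` is not, then `E₂ < E₁`.  (The
`A`-modes are last laid down at a given level, ensuring averaging holds …)» [cite: Federbush1988PhaseCellIV, §4 O3) p. 327] -/
theorem uoLt_O3 {E₁ E₂ : X} (h : effLevel E₁ = effLevel E₂) (h₁ : kind E₁ = .aMode) (h₂ : kind E₂ ≠ .aMode) :
    UOLt kind effLevel E₂ E₁ := by
  refine (uoLt_iff kind effLevel E₂ E₁).mpr (Or.inr ⟨h.symm, Or.inl ?_⟩)
  rw [h₁]
  revert h₂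
  cases kind E₂ <;> simp [ExcitationKind.rank]

/-- «In any given `S − L` configuration only some of the chunks appear … This subset will be ordered (by the subset
ordering)»: on a subtype the restricted relation keeps O1–O3 and totality (it is literally the same relation).
[cite: Federbush1988PhaseCellIV, §4 p. 327; (5.1) p. 327] -/
theorem uoLt_subtype_iff (P : X → Prop) (E₁ E₂ : {E // P E}) :
    UOLt (kind ∘ Subtype.val) (effLevel ∘ Subtype.val) E₁ E₂ ↔ UOLt kind effLevel E₁.1 E₂.1 := by
  simp only [uoLt_iff, Function.comp_apply, Subtype.coe_lt_coe]

/-! ## 2. §5 (5.3) the lattice partition of unity and its scaling -/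

/-- The lattice point `α ∈ Z^d ⊂ R^d`. [cite: Federbush1988PhaseCellIV, (5.3) p. 328] -/
def latPoint {d : ℕ} (α : Fin d → ℤ) : EuclideanSpace ℝ (Fin d) := WithLp.toLp 2 fun i => (α i : ℝ)

/-- **(5.3)** p. 328: «`1 = Σ_{α∈Z} φ_α(x)`, `x ∈ R⁴`. (5.3)  The `φ_α` are `C^∞` with the properties 1) `{φ_α(x)}` is translation
invariant.  That is, `φ_α(x) = φ(x − α)` for some function `φ(x)`. … 3) `φ(0) = 1`, 4) `φ(x) = 0` if `|x| > 2`.» — the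
properties of the generating function `φ` (property 2), lattice symmetry, «is not necessary» and is omitted; the family is
`φ_α := φ(· − α)` by 1)). [cite: Federbush1988PhaseCellIV, (5.3) p. 328] -/
structure IsLatticePOU {d : ℕ} (φ : EuclideanSpace ℝ (Fin d) → ℝ) : Prop where
  /-- «The `φ_α` are `C^∞`» -/
  smooth : ContDiff ℝ (⊤ : ℕ∞) φ
  /-- 3) «`φ(0) = 1`» -/
  at_zero : φ 0 = 1
  /-- 4) «`φ(x) = 0` if `|x| > 2`» -/
  eq_zero : ∀ x, 2 < ‖x‖ → φ x = 0
  /-- (5.3) «`1 = Σ_α φ_α(x)`» with `φ_α(x) = φ(x − α)` -/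
  sum_eq_one : ∀ x, HasSum (fun α : Fin d → ℤ => φ (x - latPoint α)) 1

/-- Property 1): the translate `φ_α(x) = φ(x − α)`. [cite: Federbush1988PhaseCellIV, (5.3) 1) p. 328] -/
def translate {d : ℕ} (φ : EuclideanSpace ℝ (Fin d) → ℝ) (α : Fin d → ℤ) (x : EuclideanSpace ℝ (Fin d)) : ℝ :=
  φ (x - latPoint α)

/-- `φ_α(α) = 1` (from 3)). [cite: Federbush1988PhaseCellIV, (5.3) 1), 3) p. 328] -/
theorem translate_self {d : ℕ} {φ : EuclideanSpace ℝ (Fin d) → ℝ} (h : IsLatticePOU φ) (α : Fin d → ℤ) :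
    translate φ α (latPoint α) = 1 := by
  simp [translate, h.at_zero]

/-- «By scaling the partition of unity, we get a partition of unity, for each `r`, with elements associated to the vertices in
`𝒱^r`.  [One is replacing `φ(x)` by `φ(N^r x)`.]  If `v ∈ 𝒱^r` we write `φ_v(x)`»: for the vertex `v = n/N^r`,
`φ_v(x) = φ(N^r x − n)`. [cite: Federbush1988PhaseCellIV, §5 p. 328] -/
def scaledPOU {d : ℕ} (φ : EuclideanSpace ℝ (Fin d) → ℝ) (N r : ℕ) (n : Fin d → ℤ) (x : EuclideanSpace ℝ (Fin d)) : ℝ :=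
  φ (((N : ℝ) ^ r) • x - latPoint n)

/-- The scaled family is again a partition of unity: `Σ_{v ∈ 𝒱^r} φ_v(x) = 1`. [cite: Federbush1988PhaseCellIV, §5 p. 328] -/
theorem hasSum_scaledPOU {d : ℕ} {φ : EuclideanSpace ℝ (Fin d) → ℝ} (h : IsLatticePOU φ) (N r : ℕ)
    (x : EuclideanSpace ℝ (Fin d)) : HasSum (fun n : Fin d → ℤ => scaledPOU φ N r n x) 1 :=
  h.sum_eq_one _

/-- `φ_v` is smooth. [cite: Federbush1988PhaseCellIV, §5 p. 328] -/
theorem contDiff_scaledPOU {d : ℕ} {φ : EuclideanSpace ℝ (Fin d) → ℝ} (h : IsLatticePOU φ) (N r : ℕ) (n : Fin d → ℤ) :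
    ContDiff ℝ (⊤ : ℕ∞) (scaledPOU φ N r n) :=
  h.smooth.comp ((contDiff_const_smul _).sub contDiff_const)

/-- **(6.8)/(6.9) for one intermediate vertex** (`s = 3`): the weights `w(Γ) = φ_{v₂}(ê)` of the paths `Γ = t(v₁, v₂, v₃)`
through the level-`r` base points `v₂` sum to `1` («Note that `Σ_Γ w(Γ) = 1`, (6.9) where we fix `v₁` and `v_s` in the sum»).
[cite: Federbush1988PhaseCellIV, (6.8)–(6.9) p. 330–331] -/
theorem hasSum_weight_one_step {d : ℕ} {φ : EuclideanSpace ℝ (Fin d) → ℝ} (h : IsLatticePOU φ) (N r : ℕ)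
    (ehat : EuclideanSpace ℝ (Fin d)) : HasSum (fun v₂ : Fin d → ℤ => scaledPOU φ N r v₂ ehat) 1 :=
  hasSum_scaledPOU h N r ehat

/-! ## 3. §6, same level (`r′ ≤ r`): the coupling (6.3)–(6.7) and the pure-gauge exercise of p. 330 -/

section Coupling

open SimpleGraph

variable {V G : Type*} [Group G] {T : SimpleGraph V}

/-- The unique path `t_{ab}` of the tree `T` from `a` to `b` (§1 p. 322 «this is a unique path»), as a walk.
[cite: Federbush1988PhaseCellIV, §1 p. 322; (6.6) p. 330] -/
def treeWalk (hT : T.IsTree) (a b : V) : T.Walk a b := ((isTree_iff_existsUnique_path.mp hT).2 a b).choose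

/-- `treeWalk` is a path. [cite: Federbush1988PhaseCellIV, §1 p. 322] -/
theorem treeWalk_isPath (hT : T.IsTree) (a b : V) : (treeWalk hT a b).IsPath :=
  ((isTree_iff_existsUnique_path.mp hT).2 a b).choose_spec.1

/-- Any path of the tree is the tree path. [cite: Federbush1988PhaseCellIV, §1 p. 322] -/
theorem eq_treeWalk (hT : T.IsTree) {a b : V} {p : T.Walk a b} (hp : p.IsPath) : p = treeWalk hT a b :=
  congrArg Subtype.val (hT.2.path_unique ⟨p, hp⟩ ⟨_, treeWalk_isPath hT a b⟩)

/-- **(6.6)** p. 330: «`u(e) = G(n−1, e₁) G(n−1, e₂) … G(n−1, e_s)`», `e₁, …, e_s` the path `t_{v(n)v_a}` — the ordered product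
of the background bond variables `F = G(n−1, ·)` along the tree path from the pinning vertex `v₀ = v(n)` to the tail `v_a` of
`e` (it depends on `e` only through `v_a`; §10 p. 334 writes it `u(v_a)`). [cite: Federbush1988PhaseCellIV, (6.6) p. 330;
(10.4) p. 334] -/
def pathProd (hT : T.IsTree) (F : V → V → G) (v₀ a : V) : G := walkProd F (treeWalk hT v₀ a)

/-- `u` at the pinning vertex itself is `Id` (empty path). [cite: Federbush1988PhaseCellIV, (6.5)–(6.6) p. 329–330] -/
@[simp] theorem pathProd_self (hT : T.IsTree) (F : V → V → G) (v₀ : V) : pathProd hT F v₀ v₀ = 1 := by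
  rw [pathProd, ← eq_treeWalk hT (Walk.IsPath.nil : (Walk.nil : T.Walk v₀ v₀).IsPath)]
  rfl

/-- **(6.7)** p. 330: «`G(n, e) = u⁻¹(e) g(n, e) u(e) G(n−1, e)`» — the bond variables of `𝓕_n = 𝒞_n × 𝓕_{n−1}` (6.2) for an
excitation of the same effective level as the edge, from the background `F = G(n−1, ·)`, the isolated field `g = g(n, ·)` and
the pinning vertex `v₀ = v(n)`. [cite: Federbush1988PhaseCellIV, (6.7) p. 330; (6.2) p. 329] -/
def couple (hT : T.IsTree) (F g : V → V → G) (v₀ : V) (a b : V) : G :=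
  (pathProd hT F v₀ a)⁻¹ * g a b * pathProd hT F v₀ a * F a b

/-- **(6.5)** p. 329: for an edge whose tail is the pinning vertex, «`G(n, e) = g(n, e) G(n−1, e)`».
[cite: Federbush1988PhaseCellIV, (6.5) p. 329] -/
theorem couple_tail_pinning (hT : T.IsTree) (F g : V → V → G) (v₀ b : V) : couple hT F g v₀ v₀ b = g v₀ b * F v₀ b := by
  simp [couple]

/-- **(6.4)** p. 329: «`G(n, e) = G(n−1, e)` for all `e` for which `g(n, e) = Id`»; in particular (6.3) for the edges of coarser
levels, where the isolated field is trivial. [cite: Federbush1988PhaseCellIV, (6.3)–(6.4) p. 329] -/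
theorem couple_of_eq_one (hT : T.IsTree) (F g : V → V → G) (v₀ : V) {a b : V} (h : g a b = 1) :
    couple hT F g v₀ a b = F a b := by
  simp [couple, h]

/-- A PURE GAUGE bond field: `F(v_av_b) = k(v_a)⁻¹ k(v_b)` for a vertex function `k`.
[cite: Federbush1988PhaseCellIV, §6 p. 329 («a pure gauge field»)] -/
def pureGauge (k : V → G) (a b : V) : G := (k a)⁻¹ * k b

/-- The product of a pure gauge along any walk telescopes: `k(start)⁻¹ k(end)`. [cite: Federbush1988PhaseCellIV, (6.6) p. 330] -/
theorem walkProd_pureGauge (k : V → G) {a b : V} (p : T.Walk a b) : walkProd (pureGauge k) p = (k a)⁻¹ * k b := by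
  induction p with
  | nil => simp
  | cons h p ih => simp [ih, pureGauge, mul_assoc]

/-- Hence `u(e) = k(v(n))⁻¹ k(v_a)` for a pure gauge background. [cite: Federbush1988PhaseCellIV, (6.6) p. 330] -/
theorem pathProd_pureGauge (hT : T.IsTree) (k : V → G) (v₀ a : V) : pathProd hT (pureGauge k) v₀ a = (k v₀)⁻¹ * k a :=
  walkProd_pureGauge k _

/-- **The reader's exercise, p. 330** («We leave to the reader to check that with this definition we have achieved our purpose
of making pure gauge background fields not contribute to plaquette variables»): on a pure gauge background `k`, the coupled
field (6.7) is the isolated field CONJUGATED by the constant `c = k(v(n))` and then gauge transformed by `k`: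
`G(n, v_av_b) = k(v_a)⁻¹ (c g(n, v_av_b) c⁻¹) k(v_b)`. [cite: Federbush1988PhaseCellIV, (6.7) p. 330] -/
theorem couple_pureGauge (hT : T.IsTree) (k : V → G) (g : V → V → G) (v₀ a b : V) :
    couple hT (pureGauge k) g v₀ a b = (k a)⁻¹ * (k v₀ * g a b * (k v₀)⁻¹) * k b := by
  simp only [couple, pathProd_pureGauge, pureGauge, mul_inv_rev, inv_inv, mul_assoc, mul_inv_cancel_left]

/-- … so the plaquette variables of `𝒞_n × 𝓕_{n−1}` are CONJUGATE to those of the isolated field `g(n, ·)`: for every closed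
loop `v₁ v₂ v₃ v₄ v₁`, `G(n, ∂p) = (c⁻¹k(v₁))⁻¹ g(n, ∂p) (c⁻¹k(v₁))` — whence `|G(n, ∂p)| = |g(n, ∂p)|` for every conjugation
invariant size `|·|`, which is what «This we desire» asks. [cite: Federbush1988PhaseCellIV, §6 p. 329–330] -/
theorem couple_plaquette_conj (hT : T.IsTree) (k : V → G) (g : V → V → G) (v₀ v₁ v₂ v₃ v₄ : V) :
    couple hT (pureGauge k) g v₀ v₁ v₂ * couple hT (pureGauge k) g v₀ v₂ v₃ * couple hT (pureGauge k) g v₀ v₃ v₄ *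
        couple hT (pureGauge k) g v₀ v₄ v₁ =
      ((k v₀)⁻¹ * k v₁)⁻¹ * (g v₁ v₂ * g v₂ v₃ * g v₃ v₄ * g v₄ v₁) * ((k v₀)⁻¹ * k v₁) := by
  simp only [couple_pureGauge]
  group

/-- In particular a conjugation-invariant «size» of the plaquette variable is unchanged: `|G(n, ∂p)| = |g(n, ∂p)|`.
[cite: Federbush1988PhaseCellIV, §6 p. 329 («one would not necessarily have `|G(n, ∂p)| = |g(n, ∂p)|` … This we desire»)] -/
theorem size_couple_plaquette {S : Type*} (size : G → S) (hsize : ∀ c x, size (c⁻¹ * x * c) = size x) (hT : T.IsTree)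
    (k : V → G) (g : V → V → G) (v₀ v₁ v₂ v₃ v₄ : V) :
    size (couple hT (pureGauge k) g v₀ v₁ v₂ * couple hT (pureGauge k) g v₀ v₂ v₃ * couple hT (pureGauge k) g v₀ v₃ v₄ *
        couple hT (pureGauge k) g v₀ v₄ v₁) = size (g v₁ v₂ * g v₂ v₃ * g v₃ v₄ * g v₄ v₁) := by
  rw [couple_plaquette_conj, hsize]

end Coupling

/-! ## 4. §6, finer levels (`r′ > r`): the averaged procedures (6.10)–(6.13) -/

section Procedures

variable {Γ G : Type*} [PseudoMetricSpace G]

/-- **(6.12)** p. 331: «*Procedure for Chunks.* We define `ū` by minimizing `Σ_Γ w(Γ) d²(ū, u(Γ))`».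
[cite: Federbush1988PhaseCellIV, (6.12) p. 331] -/
def IsAveragedPathProd (paths : Finset Γ) (w : Γ → ℝ) (u : Γ → G) (ubar : G) : Prop :=
  IsMinOn (fun y : G => ∑ γ ∈ paths, w γ * dist y (u γ) ^ 2) univ ubar

/-- With a single path of weight one (the same-level situation) `ū = u(Γ)` is a minimiser of (6.12), so that (6.13) returns
(6.7). [cite: Federbush1988PhaseCellIV, (6.12)–(6.13) p. 331; (6.7) p. 330] -/
theorem isAveragedPathProd_singleton (u : Γ → G) (γ : Γ) : IsAveragedPathProd {γ} (fun _ => 1) u (u γ) := by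
  intro y _
  simp [dist_self]

variable [Group G]

/-- **(6.10)** p. 331: «*Procedure for Modes.* We define `G_Γ(n, e)` by `u⁻¹(Γ) g(n, e) u(Γ) G(n−1, e)`» — for each multi-level
path `Γ` with product `u(Γ)`. [cite: Federbush1988PhaseCellIV, (6.10) p. 331] -/
def coupleAlong (u : Γ → G) (gne Gprev : G) (γ : Γ) : G := (u γ)⁻¹ * gne * u γ * Gprev

/-- **(6.11)** p. 331: «and find `G(n, e)` by minimizing `Σ_Γ w(Γ) d²(G(n, e), G_Γ(n, e))`» — `x` is a minimiser of the
weighted sum of squared distances to the `G_Γ(n, e)` (the sum over the finitely many `Γ` of positive weight, (6.8)); «we will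
operate in a situation where the indicated minima are unique». [cite: Federbush1988PhaseCellIV, (6.11) p. 331] -/
def IsModeCoupling (paths : Finset Γ) (w : Γ → ℝ) (u : Γ → G) (gne Gprev : G) (x : G) : Prop :=
  IsMinOn (fun y : G => ∑ γ ∈ paths, w γ * dist y (coupleAlong u gne Gprev γ) ^ 2) univ x

/-- **(6.13)** p. 331: «We then set `G(n, e) = ū⁻¹ g(n, e) ū G(n−1, e)`». [cite: Federbush1988PhaseCellIV, (6.13) p. 331] -/
def chunkCouple (ubar gne Gprev : G) : G := ubar⁻¹ * gne * ubar * Gprev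

end Procedures

/-! ## 5. §7 gauge transformations and the Gauge Twist Relations -/

section Twist

open SimpleGraph

variable {V G : Type*} [Group G] {T : SimpleGraph V}

/-- A gauge transformation «is exactly an assignment for all vertices of an element of `G`», `h_v(𝒢)`; it acts on bond fields
by `F^𝒢(v_av_b) = h(v_a) F(v_av_b) h(v_b)⁻¹` (CONVENTION: print does not display the action; with the opposite convention
`h(v_a)⁻¹ F h(v_b)` every statement below holds with `h` replaced by `h⁻¹`). [cite: Federbush1988PhaseCellIV, §7 p. 331] -/
def gaugeAct (h : V → G) (F : V → V → G) (a b : V) : G := h a * F a b * (h b)⁻¹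

/-- «`𝒞_i^g` … the isolated field that is obtained by transforming each edge assignment `g(i, e)` to the assignment
`g g(i, e) g⁻¹` (for a fixed `g ∈ G`)». [cite: Federbush1988PhaseCellIV, §7 p. 331] -/
def conjField (c : G) (g : V → V → G) (a b : V) : G := c * g a b * c⁻¹

/-- «`1` is the "trivial" field all of whose edge assignments are the identity.» [cite: Federbush1988PhaseCellIV, (7.2) p. 331] -/
def trivialField : V → V → G := fun _ _ => 1

/-- `1^𝒢` is the pure gauge `h(v_a) h(v_b)⁻¹`. [cite: Federbush1988PhaseCellIV, (7.2) p. 331] -/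
theorem gaugeAct_trivialField (h : V → G) (a b : V) : gaugeAct h trivialField a b = h a * (h b)⁻¹ := by
  simp [gaugeAct, trivialField]

/-- Gauge transformations compose: `(F^{h₂})^{h₁} = F^{h₁h₂}`. [cite: Federbush1988PhaseCellIV, §7 p. 331] -/
theorem gaugeAct_gaugeAct (h₁ h₂ : V → G) (F : V → V → G) :
    gaugeAct h₁ (gaugeAct h₂ F) = gaugeAct (fun v => h₁ v * h₂ v) F := by
  funext a b
  simp [gaugeAct, mul_assoc]

/-- The path product of a gauge transformed field: `u^𝒢 = h(start) u h(end)⁻¹`. [cite: Federbush1988PhaseCellIV, (6.6) p. 330;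
§7 p. 331] -/
theorem walkProd_gaugeAct (h : V → G) (F : V → V → G) {a b : V} (p : T.Walk a b) :
    walkProd (gaugeAct h F) p = h a * walkProd F p * (h b)⁻¹ := by
  induction p with
  | nil => simp
  | cons hadj p ih => simp [ih, gaugeAct, mul_assoc]

/-- **Gauge Twist Relation 1** (7.1) p. 331: «`(𝒞 × 𝓕)^𝒢 = 𝒞^{t(𝒢)} × 𝓕^𝒢`», `𝒞^{t(𝒢)} = 𝒞` conjugated by `h_{v(n)}(𝒢)` — PROVED
for the same-level coupling (6.5)–(6.7) (and trivially for (6.3)): coupling the conjugated isolated field to the transformed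
background gives the transform of the coupled field. [cite: Federbush1988PhaseCellIV, Gauge Twist Relation 1 (7.1) p. 331] -/
theorem gaugeTwist₁ (hT : T.IsTree) (h : V → G) (F g : V → V → G) (v₀ : V) :
    couple hT (gaugeAct h F) (conjField (h v₀) g) v₀ = gaugeAct h (couple hT F g v₀) := by
  funext a b
  simp only [couple, pathProd, walkProd_gaugeAct, conjField, gaugeAct, mul_inv_rev, inv_inv, mul_assoc,
    inv_mul_cancel_left]

/-- (7.1) in the case (6.3) (`r′ < r`, the excitation does not touch the edge): trivially `𝓕^𝒢 = 𝓕^𝒢`.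
[cite: Federbush1988PhaseCellIV, (6.3) p. 329; (7.1) p. 331] -/
theorem gaugeTwist₁_coarse (h : V → G) (F : V → V → G) : gaugeAct h F = gaugeAct h F := rfl

/-- Laying down a finite sequence of same-level excitations `(g₁, v₁), …, (g_n, v_n)` on a background `F`:
`𝓕_n = 𝒞_n × (𝒞_{n−1} × ( … × (𝒞₁ × F)))` ((6.1)–(6.2) iterated). [cite: Federbush1988PhaseCellIV, (6.1)–(6.2) p. 329] -/
def layDown (hT : T.IsTree) (F : V → V → G) : List ((V → V → G) × V) → (V → V → G)
  | [] => F
  | (g, v) :: l => couple hT (layDown hT F l) g v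

/-- The excitations with their isolated fields conjugated as in (7.2): `𝒞_i ↦ 𝒞_i^{t(𝒢)} = 𝒞_i^{h_{v(i)}(𝒢)}`.
[cite: Federbush1988PhaseCellIV, (7.2) p. 331] -/
def twistAll (h : V → G) : List ((V → V → G) × V) → List ((V → V → G) × V)
  | [] => []
  | (g, v) :: l => (conjField (h v) g, v) :: twistAll h l

/-- **Gauge Twist Relation 2** (7.2) p. 331: «`(𝒞_n × … × 𝒞₁)^𝒢 = 𝒞_n^{t(𝒢)} × … × 𝒞₁^{t(𝒢)} × 1^𝒢`» — «obtained by induction»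
from (7.1), here for any background in place of `1` and every finite sequence of same-level couplings.
[cite: Federbush1988PhaseCellIV, Gauge Twist Relation 2 (7.2) p. 331] -/
theorem gaugeTwist₂ (hT : T.IsTree) (h : V → G) (F : V → V → G) (l : List ((V → V → G) × V)) :
    gaugeAct h (layDown hT F l) = layDown hT (gaugeAct h F) (twistAll h l) := by
  induction l with
  | nil => rfl
  | cons gv l ih =>
    obtain ⟨g, v⟩ := gv
    simp only [layDown, twistAll, ← gaugeTwist₁, ih]

/-- (7.2) verbatim, with the trivial background `1`. [cite: Federbush1988PhaseCellIV, (7.2) p. 331] -/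
theorem gaugeTwist₂_trivial (hT : T.IsTree) (h : V → G) (l : List ((V → V → G) × V)) :
    gaugeAct h (layDown hT trivialField l) = layDown hT (gaugeAct h trivialField) (twistAll h l) :=
  gaugeTwist₂ hT h trivialField l

end Twist

/-! ## 6. §10 (10.4): the radial axial gauge of the tree `t_v` -/

section TreeGauge

open SimpleGraph

variable {V G : Type*} [Group G] {T : SimpleGraph V}

/-- **(10.4)** p. 334: «For any lattice vertex, `v′`, we set `u(v′) = u(t_{vv′})` … The assignment in the new gauge, `h(e)`, for
`e = v_av_b` in `ℒ^r` is `h(e) = u(v_a) g(e) u⁻¹(v_b)`» — the gauge transform of `g` by the path products from the centre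
`v`. [cite: Federbush1988PhaseCellIV, (10.4) p. 334] -/
def treeGauge (hT : T.IsTree) (g : V → V → G) (v a b : V) : G := pathProd hT g v a * g a b * (pathProd hT g v b)⁻¹

/-- (10.4) IS a gauge transformation in the sense of §7, by `h = u`. [cite: Federbush1988PhaseCellIV, (10.4) p. 334; §7 p. 331] -/
theorem treeGauge_eq_gaugeAct (hT : T.IsTree) (g : V → V → G) (v : V) :
    treeGauge hT g v = gaugeAct (pathProd hT g v) g := rfl

/-- **«We switch to a gauge where the assignments to the bonds of `t_v` are trivial (= Id)»** (p. 334): in the gauge (10.4)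
every TREE edge carries the identity (the path to `v_b` is the path to `v_a` followed by `e`, or conversely; PROVED for every
tree and every edge orientation, using the orientation rule `g(−e) = g(e)⁻¹`). [cite: Federbush1988PhaseCellIV, (10.4) p. 334] -/
theorem treeGauge_eq_one_of_adj (hT : T.IsTree) (g : V → V → G) (hg : ∀ a b, T.Adj a b → g b a = (g a b)⁻¹) (v : V)
    {a b : V} (hab : T.Adj a b) : treeGauge hT g v a b = 1 := by
  classical
  unfold treeGauge pathProd
  by_cases ha : a ∈ (treeWalk hT v b).support
  · have hb : treeWalk hT v b = (treeWalk hT v a).concat hab :=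
      hT.2.path_concat (treeWalk_isPath hT v a) (treeWalk_isPath hT v b) hab ha
    rw [hb, walkProd_concat, mul_inv_rev, mul_assoc, mul_inv_cancel_left, mul_inv_cancel]
  · have hb' : b ∈ (treeWalk hT v a).support :=
      hT.2.mem_support_of_ne_mem_support_of_adj_of_isPath (treeWalk_isPath hT v a) (treeWalk_isPath hT v b) hab ha
    have ha' : treeWalk hT v a = (treeWalk hT v b).concat hab.symm :=
      hT.2.path_concat (treeWalk_isPath hT v b) (treeWalk_isPath hT v a) hab.symm hb'
    rw [ha', walkProd_concat, hg a b hab, mul_assoc, mul_assoc, inv_mul_cancel_left, mul_inv_cancel]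

/-- The same gauge leaves plaquette variables conjugate (it is a gauge transformation): for a closed loop `v₁v₂v₃v₄v₁`,
`h(∂p) = u(v₁) g(∂p) u(v₁)⁻¹`. [cite: Federbush1988PhaseCellIV, (10.4) p. 334; §7 p. 331] -/
theorem treeGauge_plaquette (hT : T.IsTree) (g : V → V → G) (v v₁ v₂ v₃ v₄ : V) :
    treeGauge hT g v v₁ v₂ * treeGauge hT g v v₂ v₃ * treeGauge hT g v v₃ v₄ * treeGauge hT g v v₄ v₁ =
      pathProd hT g v v₁ * (g v₁ v₂ * g v₂ v₃ * g v₃ v₄ * g v₄ v₁) * (pathProd hT g v v₁)⁻¹ := by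
  simp only [treeGauge, mul_assoc, inv_mul_cancel_left]

end TreeGauge

/-! ## 7. (v1.1) Gauge Twist Relation 1 for the averaged procedures (6.10)–(6.13) (`r′ > r`) -/

section TwistAveraged

variable {Γ G : Type*} [Group G]

/-- Under a gauge transformation the multi-level path products `u(Γ)`, all from `v(n)` to `v_a`, become `c u(Γ) a⁻¹`
(`c = h_{v(n)}`, `a = h_{v_a}`), the isolated field `g(n,e)` becomes `c g(n,e) c⁻¹` (`𝒞^{t(𝒢)}`) and `G(n−1,e)` becomes
`a G(n−1,e) b⁻¹` (`b = h_{v_b}`); then every `G_Γ(n, e)` of (6.10) becomes `a G_Γ(n, e) b⁻¹`.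
[cite: Federbush1988PhaseCellIV, (6.10) p. 331; (7.1) p. 331] -/
theorem coupleAlong_twist (u : Γ → G) (gne Gprev c a b : G) (γ : Γ) :
    coupleAlong (fun γ => c * u γ * a⁻¹) (c * gne * c⁻¹) (a * Gprev * b⁻¹) γ = a * coupleAlong u gne Gprev γ * b⁻¹ := by
  simp only [coupleAlong, mul_inv_rev, inv_inv, mul_assoc, inv_mul_cancel_left]

/-- (6.13) transforms as (7.1) demands: `(c ū a⁻¹)⁻¹ (c g c⁻¹) (c ū a⁻¹) (a G(n−1,e) b⁻¹) = a [ū⁻¹ g ū G(n−1,e)] b⁻¹`.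
[cite: Federbush1988PhaseCellIV, (6.13) p. 331; Gauge Twist Relation 1 (7.1) p. 331] -/
theorem chunkCouple_twist (ubar gne Gprev c a b : G) :
    chunkCouple (c * ubar * a⁻¹) (c * gne * c⁻¹) (a * Gprev * b⁻¹) = a * chunkCouple ubar gne Gprev * b⁻¹ := by
  simp only [chunkCouple, mul_inv_rev, inv_inv, mul_assoc, inv_mul_cancel_left]

variable [PseudoMetricSpace G] [IsIsometricSMul G G] [IsIsometricSMul Gᵐᵒᵖ G]

/-- For a BI-INVARIANT distance on `G` the objective of (6.11) transforms by the isometry `y ↦ a y b⁻¹`: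
`d(a y b⁻¹, a z b⁻¹) = d(y, z)`. [cite: Federbush1988PhaseCellIV, (6.11) p. 331] -/
theorem dist_conj_eq (a b y z : G) : dist (a * y * b⁻¹) (a * z * b⁻¹) = dist y z := by
  rw [dist_mul_right, dist_mul_left]

/-- **Gauge Twist Relation 1 for the Procedure for Modes (6.10)–(6.11)**: if `x` minimises (6.11) for the data `(u, g, G(n−1,e))`
then `a x b⁻¹ = (x)^𝒢` minimises (6.11) for the gauge-transformed data `(c u a⁻¹, c g c⁻¹, a G(n−1,e) b⁻¹)` — so with print's
«indicated minima are unique» the averaged coupling satisfies (7.1) as well (bi-invariant `d`).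
[cite: Federbush1988PhaseCellIV, (6.10)–(6.11), Gauge Twist Relation 1 (7.1) p. 331] -/
theorem IsModeCoupling.twist {paths : Finset Γ} {w : Γ → ℝ} {u : Γ → G} {gne Gprev x : G}
    (h : IsModeCoupling paths w u gne Gprev x) (c a b : G) :
    IsModeCoupling paths w (fun γ => c * u γ * a⁻¹) (c * gne * c⁻¹) (a * Gprev * b⁻¹) (a * x * b⁻¹) := by
  have key : ∀ z : G, (∑ γ ∈ paths, w γ * dist (a * z * b⁻¹) (coupleAlong (fun γ => c * u γ * a⁻¹) (c * gne * c⁻¹)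
      (a * Gprev * b⁻¹) γ) ^ 2) = ∑ γ ∈ paths, w γ * dist z (coupleAlong u gne Gprev γ) ^ 2 := fun z =>
    Finset.sum_congr rfl fun γ _ => by rw [coupleAlong_twist, dist_conj_eq]
  rw [IsModeCoupling, isMinOn_univ_iff] at h ⊢
  intro y
  have hy : y = a * (a⁻¹ * y * b) * b⁻¹ := by group
  rw [key x, hy, key (a⁻¹ * y * b)]
  exact h _

/-- **Gauge Twist Relation 1 for the Procedure for Chunks (6.12)**: if `ū` minimises (6.12) for the path products `u(Γ)` then
`c ū a⁻¹` minimises it for the transformed products `c u(Γ) a⁻¹` (bi-invariant `d`); then (6.13) transforms by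
`chunkCouple_twist`. [cite: Federbush1988PhaseCellIV, (6.12) p. 331; (7.1) p. 331] -/
theorem IsAveragedPathProd.twist {paths : Finset Γ} {w : Γ → ℝ} {u : Γ → G} {ubar : G}
    (h : IsAveragedPathProd paths w u ubar) (c a : G) :
    IsAveragedPathProd paths w (fun γ => c * u γ * a⁻¹) (c * ubar * a⁻¹) := by
  have key : ∀ z : G, (∑ γ ∈ paths, w γ * dist (c * z * a⁻¹) (c * u γ * a⁻¹) ^ 2) =
      ∑ γ ∈ paths, w γ * dist z (u γ) ^ 2 := fun z => Finset.sum_congr rfl fun γ _ => by rw [dist_conj_eq]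
  rw [IsAveragedPathProd, isMinOn_univ_iff] at h ⊢
  intro y
  have hy : y = c * (c⁻¹ * y * a) * a⁻¹ := by group
  rw [key ubar, hy, key (c⁻¹ * y * a)]
  exact h _

end TwistAveraged

/-! ## 8. (v1.1) The weights (6.8) for any number of intermediate vertices and (6.9) `Σ_Γ w(Γ) = 1` -/

section Weights

variable {d : ℕ}

/-- A single coordinate is bounded by the Euclidean norm. [cite: Federbush1988PhaseCellIV, (5.3) 4) p. 328] -/
theorem abs_apply_le_norm (x : EuclideanSpace ℝ (Fin d)) (k : Fin d) : |x k| ≤ ‖x‖ := by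
  simpa using PiLp.norm_apply_le x k

/-- The lattice points `α` with `φ(y − α) ≠ 0` lie in an explicit finite box around `y` (property 4): `φ = 0` outside `|x| ≤ 2`).
[cite: Federbush1988PhaseCellIV, (5.3) 4) p. 328] -/
def pouWindow (y : EuclideanSpace ℝ (Fin d)) : Finset (Fin d → ℤ) :=
  Fintype.piFinset fun k => Finset.Icc (⌊y k⌋ - 2) (⌊y k⌋ + 3)

/-- Outside the box the translate vanishes. [cite: Federbush1988PhaseCellIV, (5.3) 4) p. 328] -/
theorem pou_translate_eq_zero {φ : EuclideanSpace ℝ (Fin d) → ℝ} (h : IsLatticePOU φ) {y : EuclideanSpace ℝ (Fin d)}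
    {α : Fin d → ℤ} (hα : α ∉ pouWindow y) : φ (y - latPoint α) = 0 := by
  apply h.eq_zero
  rw [pouWindow, Fintype.mem_piFinset] at hα
  push Not at hα
  obtain ⟨k, hk⟩ := hα
  rw [Finset.mem_Icc, not_and_or, not_le, not_le] at hk
  have h1 := Int.floor_le (y k)
  have h2 := Int.lt_floor_add_one (y k)
  have hcoord : 2 < |(y - latPoint α) k| := by
    have : (y - latPoint α) k = y k - α k := by simp [latPoint]
    rw [this]
    rcases hk with hk | hk
    · have : (α k : ℝ) + 1 ≤ ⌊y k⌋ - 2 := by exact_mod_cast hk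
      rw [abs_of_nonneg (by linarith)]; linarith
    · have : (⌊y k⌋ : ℝ) + 3 + 1 ≤ α k := by exact_mod_cast hk
      rw [abs_of_neg (by linarith)]; linarith
  exact lt_of_lt_of_le hcoord (abs_apply_le_norm _ k)

/-- Hence the (5.3)-sum is a FINITE sum over the box: `Σ_{α ∈ box} φ(y − α) = 1`. [cite: Federbush1988PhaseCellIV, (5.3) p. 328] -/
theorem sum_pouWindow {φ : EuclideanSpace ℝ (Fin d) → ℝ} (h : IsLatticePOU φ) (y : EuclideanSpace ℝ (Fin d)) :
    ∑ α ∈ pouWindow y, φ (y - latPoint α) = 1 :=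
  ((hasSum_sum_of_ne_finset_zero fun _ hα => pou_translate_eq_zero h hα).unique (h.sum_eq_one y))

/-- **(6.8)** p. 330: «`w(Γ) = φ_{v₂}(ê) φ_{v₃}(ê) … φ_{v_{s−1}}(ê)`, where we here view `v₂ ∈ 𝒱^r, v₃ ∈ 𝒱^{r+1}, …, v_{s−1} ∈ 𝒱^{r+s−3}`
in deciding the scales of the `φ`'s» — the weight of the chain through the intermediate vertices `V i ∈ 𝒱^{ℓ(i)}` (labels),
`ℓ i = r + i`. [cite: Federbush1988PhaseCellIV, (6.8) p. 330] -/
def chainWeight (φ : EuclideanSpace ℝ (Fin d) → ℝ) (N : ℕ) {m : ℕ} (ℓ : Fin m → ℕ) (ehat : EuclideanSpace ℝ (Fin d))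
    (V : Fin m → (Fin d → ℤ)) : ℝ :=
  ∏ i, scaledPOU φ N (ℓ i) (V i) ehat

/-- **(6.9)** p. 330–331: «`Σ_Γ w(Γ) = 1`, (6.9) where we fix `v₁` and `v_s` in the sum» — for ANY number `m = s − 2` of
intermediate vertices and any scales `ℓ(i)`: the sum over all `(v₂, …, v_{s−1})` of (6.8) is `Π_i Σ_{v_i} φ_{v_i}(ê) = 1`.
[cite: Federbush1988PhaseCellIV, (6.9) p. 330–331] -/
theorem hasSum_chainWeight {φ : EuclideanSpace ℝ (Fin d) → ℝ} (h : IsLatticePOU φ) (N : ℕ) {m : ℕ} (ℓ : Fin m → ℕ)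
    (ehat : EuclideanSpace ℝ (Fin d)) : HasSum (chainWeight φ N ℓ ehat) 1 := by
  unfold chainWeight scaledPOU
  set y : Fin m → EuclideanSpace ℝ (Fin d) := fun i => ((N : ℝ) ^ ℓ i) • ehat with hy
  have hfin : ∑ V ∈ Fintype.piFinset (fun i => pouWindow (y i)), ∏ i, φ (y i - latPoint (V i)) = 1 := by
    rw [← Finset.prod_univ_sum (fun i => pouWindow (y i)) (fun i α => φ (y i - latPoint α))]
    simp [sum_pouWindow h]
  rw [← hfin]
  refine hasSum_sum_of_ne_finset_zero fun V hV => ?_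
  rw [Fintype.mem_piFinset] at hV
  push Not at hV
  obtain ⟨i, hi⟩ := hV
  exact Finset.prod_eq_zero (Finset.mem_univ i) (pou_translate_eq_zero h hi)

end Weights

/-! ## 9. (v1.2) The minimisations (6.11)/(6.12): existence on a compact group, uniqueness in the single-path case -/

section Minimisers

variable {Γ G : Type*} [PseudoMetricSpace G]

/-- **(6.12) is solvable on a compact group**: the objective `y ↦ Σ_Γ w(Γ) d²(y, u(Γ))` is continuous, so on a compact
(nonempty) `G` a minimiser `ū` EXISTS (print: «we will operate in a situation where the indicated minima are unique» —
uniqueness is print's small-field claim and is not asserted here). [cite: Federbush1988PhaseCellIV, (6.12) p. 331] -/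
theorem exists_isAveragedPathProd [CompactSpace G] [Nonempty G] (paths : Finset Γ) (w : Γ → ℝ) (u : Γ → G) :
    ∃ ubar, IsAveragedPathProd paths w u ubar := by
  have hc : Continuous fun y : G => ∑ γ ∈ paths, w γ * dist y (u γ) ^ 2 := by fun_prop
  obtain ⟨x, -, hx⟩ := isCompact_univ.exists_isMinOn Set.univ_nonempty hc.continuousOn
  exact ⟨x, hx⟩

/-- In a metric space the single-path case of (6.12) has the UNIQUE minimiser `ū = u(Γ)` (so (6.13) returns exactly (6.7)).
[cite: Federbush1988PhaseCellIV, (6.12)–(6.13) p. 331; (6.7) p. 330] -/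
theorem isAveragedPathProd_singleton_iff {G : Type*} [MetricSpace G] (u : Γ → G) (γ : Γ) (x : G) :
    IsAveragedPathProd {γ} (fun _ => 1) u x ↔ x = u γ := by
  refine ⟨fun h => ?_, fun h => h ▸ isAveragedPathProd_singleton u γ⟩
  have h1 := (isMinOn_univ_iff.mp h) (u γ)
  simp only [Finset.sum_singleton, one_mul, dist_self, ne_eq, OfNat.ofNat_ne_zero, not_false_eq_true, zero_pow] at h1
  exact dist_le_zero.mp (by nlinarith [dist_nonneg (x := x) (y := u γ)])

variable [Group G]

/-- **(6.11) is solvable on a compact group**: a minimiser `G(n, e)` of `Σ_Γ w(Γ) d²(·, G_Γ(n, e))` EXISTS.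
[cite: Federbush1988PhaseCellIV, (6.11) p. 331] -/
theorem exists_isModeCoupling [CompactSpace G] (paths : Finset Γ) (w : Γ → ℝ) (u : Γ → G) (gne Gprev : G) :
    ∃ x, IsModeCoupling paths w u gne Gprev x := by
  have hc : Continuous fun y : G => ∑ γ ∈ paths, w γ * dist y (coupleAlong u gne Gprev γ) ^ 2 := by fun_prop
  obtain ⟨x, -, hx⟩ := isCompact_univ.exists_isMinOn Set.univ_nonempty hc.continuousOn
  exact ⟨x, hx⟩

/-- The single-path case of (6.10)–(6.11): `G_Γ(n, e)` itself is a minimiser … [cite: Federbush1988PhaseCellIV, (6.10)–(6.11) p. 331] -/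
theorem isModeCoupling_singleton (u : Γ → G) (gne Gprev : G) (γ : Γ) :
    IsModeCoupling {γ} (fun _ => 1) u gne Gprev (coupleAlong u gne Gprev γ) := by
  rw [IsModeCoupling, isMinOn_univ_iff]
  intro y
  simp [dist_self]

/-- … and in a metric space the unique one: `G(n, e) = u⁻¹(Γ) g(n, e) u(Γ) G(n−1, e)`, i.e. (6.7) again.
[cite: Federbush1988PhaseCellIV, (6.10)–(6.11) p. 331; (6.7) p. 330] -/
theorem isModeCoupling_singleton_iff {G : Type*} [MetricSpace G] [Group G] (u : Γ → G) (gne Gprev : G) (γ : Γ) (x : G) :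
    IsModeCoupling {γ} (fun _ => 1) u gne Gprev x ↔ x = coupleAlong u gne Gprev γ := by
  refine ⟨fun h => ?_, fun h => h ▸ isModeCoupling_singleton u gne Gprev γ⟩
  have h1 := (isMinOn_univ_iff.mp h) (coupleAlong u gne Gprev γ)
  simp only [Finset.sum_singleton, one_mul, dist_self, ne_eq, OfNat.ofNat_ne_zero, not_false_eq_true, zero_pow] at h1
  exact dist_le_zero.mp (by nlinarith [dist_nonneg (x := x) (y := coupleAlong u gne Gprev γ)])

end Minimisers

end PhaseCellIVCoupling

end

end Literature.MathematicalPhysics.QuantumFieldTheory.Federbush1986
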